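import Summits.QuantumFields.YangMills.Theorems.LuscherReductionDressedRitzLiftLeakageDressedSectors
import Mathlib.Algebra.Ring.GeomSum
import Mathlib.Analysis.SpecialFunctions.Exp
import HarnessLib

/-!
# Crux `DressedRitz` (stmt-QuantumFields-20205), line «polyakovlift» r5, stub S-LEAK `stub_liftLeakage` — support XIV:
# the KINEMATIC gain of time-dressing: below the own level every state's lever is cut to `λ_own²/(m+1)²` — (RL) ⟸ slow levers + an `L`-UNIFORM weight bound

Support module (fleet seat ym-20205-polyakovlift-s1 gen 1; `--supports stmt-QuantumFields-20205`, helper, no closure claim) for the registered stub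
`Summit.QuantumFields.YangMills.Cruxes.DressedRitz.PolyakovLift.stub_liftLeakage` (skeleton r5, sha16 8b6782afbcc2a19a): clause (o4) for the dressed
lifted channel vectors `u_i = K_β^[m] x_i`, `m = dressSteps L = L`, `x_i = liftVec β φ g_i`.  Sharpening of support XI-b (`…LiftLeakageDressedSectors.lean`,
p541272), where the stiff sector entered through the dressing ratio `(Λ/λ_own)^{2m}` and a spectral GAP below the own level was needed to make it small.

THE KINEMATIC FACT (§A, `kinematic_pow_bound`): for `0 ≤ x ≤ μ` and every `m`,  `(m+1)²·(μ − x)²·x^{2m} ≤ μ^{2m+2}`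
(`μ^{m+1} − x^{m+1} = (μ−x)Σ_{i≤m} μ^i x^{m−i} ≥ (m+1)(μ−x)x^m`).  Read with `x = λ_j` an exact fine level BELOW the own level `μ = λ_{j₀}` and `m` the
dressing depth: the contribution `(λ_j − μ)²λ_j^{2m}⟨x,ψ_j⟩²` of level `j` to the dressed squared residual at the approximate eigenvalue `a = μ` is at most
`μ^{2m}·(μ²/(m+1)²)·⟨x,ψ_j⟩²` — the dressing converts EVERY lever below the own level into `μ²/(m+1)² ≤ λ₀²/L²` (at `m = L`), with NO gap hypothesis and
uniformly in how many such levels there are; the same holds for the whole dominated remainder once `(m+1)²Λ^{2m} ≤ μ^{2m}` (e.g. `Λ ≤ μ/e`,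
`gap_of_le_div_exp`; at fixed lattice `levelValue N → 0`, so such an `N` always exists).

§B femto (`x` physical, `ψ_0 … ψ_{N−1}` exact physical `l2`-orthonormal eigenfamily with levels `λ_j` dominating at `Λ ≥ 0`, own index `j₀`, `μ = λ_{j₀}`,
a "slow" index set `S ⊆ Fin N` chosen by the user with `λ_j ≤ μ` off `S`):
* `normSq_split_eigenfamily` — `‖x‖² = Σ_j ⟨x,ψ_j⟩² + ‖r_N‖²`;
* ★★ `residual_iterate_le_kinematic` —
  `‖(K_β − μ)K_β^[m]x‖² ≤ Σ_{j∈S} (λ_j − μ)²λ_j^{2m}⟨x,ψ_j⟩² + (μ^{2m+2}/(m+1)²)·(‖x‖² − Σ_{j∈S}⟨x,ψ_j⟩²)`;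
* ★★ `residual_iterate_le_of_slow_outside` — hence `‖(K_β − μ)v‖² ≤ ρ‖v‖²` (`v = K_β^[m]x`) as soon as
  (SLOW) `Σ_{j∈S} (λ_j − μ)²·λ_j^{2m}·⟨x,ψ_j⟩² ≤ ρ₁·μ^{2m}⟨x,ψ_{j₀}⟩²` and (OUT) `(μ²/(m+1)²)·(‖x‖² − Σ_{j∈S}⟨x,ψ_j⟩²) ≤ ρ₂·⟨x,ψ_{j₀}⟩²`, `ρ₁ + ρ₂ ≤ ρ`;
* ★★★ `leakageClause_dressed_of_slow_outside` — the press-button in the stub's currency at `m = dressSteps L = L`, `μ ≤ λ₀`: the VERBATIM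
  `PolyakovLift.LeakageClause k C β (dressedLiftFamily β φ g)` from, per channel `i` (undressed `x_i = liftVec β φ g_i`, own weight `w₀ = ⟨x_i,ψ_{j₀}⟩²`):
    (SLOW) `Σ_{j∈S} (λ_j − μ)²·(λ_j)^{2L}·⟨x_i,ψ_j⟩² ≤ C₁(λ³/L²)λ₀²·μ^{2L}·w₀`  — first-order degenerate perturbation theory in the zero-mode band:
           weights `O(λ)·w₀` at levers `(λ_j − μ)² ≍ (λλ₀/L)²`, dressing factors `(λ_j/μ)^{2L} = e^{±2LΔE} = O(1)`;
    (OUT)  `‖x_i‖² − Σ_{j∈S}⟨x_i,ψ_j⟩² ≤ C₂λ³·w₀`  — the undressed flowed-Polyakov insertion state lies in the slow spectral subspace up to RELATIVE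
           WEIGHT `O(λ³)`, UNIFORMLY IN `L` (no lever, no gap, no `L⁻²`: the dressing supplies the `L⁻²`);  `C₁ + C₂ ≤ C`;
  `residual_dressedLiftVec_le_of_slow_outside` — the same as the per-vector input (RL) of the closing press-buttons IX∕X for ONE dressed reference lift.

So after XIV the renormalisation-group content of S-LEAK's (RL) is located as: (SLOW) = the standard `O(λ)` admixture estimate inside the zero-mode band
(the same input as S-POS∕S-UNIV′), and (OUT) = an `L`-uniform bound `O(λ³)` on the relative weight of the undressed insertion state OUTSIDE the band (lead's
hazard numbers: two-hard-gluon weight `≍ κλ⁴/L`, soft pairs `≍ 10⁻³λ⁴` — one power of `λ` to spare).  Not proved here; no claim on the stub.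

HONEST FRAMING: fixed-lattice functional analysis on the conditional femto rung R2b1; `stub_liftLeakage` stays OPEN; nothing here bears on infinite
volume, the continuum limit or the Clay gap.
References: T. Kato, J. Phys. Soc. Japan 4 (1949) 334 [cite: Kato1949, §1]; M. Reed, B. Simon IV (1978) Thm XIII.1 [cite: ReedSimonIV1978];
M. Lüscher, U. Wolff, NPB 339 (1990) 222 [cite: LuscherWolff1990, §2]; M. Lüscher, NPB 219 (1983) 233 [cite: Luscher1983, §3].
-/

set_option autoImplicit false

noncomputable section

open MeasureTheory Filter Topology Finset
open Literature.MathematicalPhysics.QuantumFieldTheory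
open Literature.MathematicalPhysics.QuantumLattice
open Literature.Analysis.OperatorTheory
open scoped BigOperators

namespace Summit.QuantumFields.YangMills.Theorems.FemtoTransferGap.LiftLeak

/-! ## §A The kinematic inequality -/

section Kinematic

/-- **`(m+1)·(μ − x)·x^m ≤ μ^{m+1}` for `0 ≤ x ≤ μ`** (`μ^{m+1} − x^{m+1} = (μ − x)·Σ_{i≤m} μ^i x^{m−i} ≥ (m+1)(μ−x)x^m`). [folklore] -/
theorem kinematic_bound (m : ℕ) {x μ : ℝ} (hx : 0 ≤ x) (hxμ : x ≤ μ) :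
    ((m : ℝ) + 1) * ((μ - x) * x ^ m) ≤ μ ^ (m + 1) := by
  have hgeom : (∑ i ∈ range (m + 1), μ ^ i * x ^ (m + 1 - 1 - i)) * (μ - x) = μ ^ (m + 1) - x ^ (m + 1) :=
    (Commute.all μ x).geom_sum₂_mul (m + 1)
  have hterm : ∀ i ∈ range (m + 1), x ^ m ≤ μ ^ i * x ^ (m + 1 - 1 - i) := by
    intro i hi
    have hi' : i ≤ m := Nat.lt_succ_iff.mp (mem_range.mp hi)
    have hsplit : x ^ m = x ^ i * x ^ (m - i) := by rw [← pow_add, Nat.add_sub_cancel' hi']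
    rw [hsplit, show m + 1 - 1 - i = m - i by omega]
    exact mul_le_mul_of_nonneg_right (pow_le_pow_left₀ hx hxμ i) (pow_nonneg hx _)
  have hsum : ((m : ℝ) + 1) * x ^ m ≤ ∑ i ∈ range (m + 1), μ ^ i * x ^ (m + 1 - 1 - i) := by
    calc ((m : ℝ) + 1) * x ^ m = ∑ _i ∈ range (m + 1), x ^ m := by rw [sum_const, card_range, nsmul_eq_mul]; push_cast; ring
      _ ≤ ∑ i ∈ range (m + 1), μ ^ i * x ^ (m + 1 - 1 - i) := sum_le_sum hterm
  have hμx : 0 ≤ μ - x := sub_nonneg.mpr hxμ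
  calc ((m : ℝ) + 1) * ((μ - x) * x ^ m) = (((m : ℝ) + 1) * x ^ m) * (μ - x) := by ring
    _ ≤ (∑ i ∈ range (m + 1), μ ^ i * x ^ (m + 1 - 1 - i)) * (μ - x) := mul_le_mul_of_nonneg_right hsum hμx
    _ = μ ^ (m + 1) - x ^ (m + 1) := hgeom
    _ ≤ μ ^ (m + 1) := sub_le_self _ (pow_nonneg hx _)

/-- ★ **THE KINEMATIC FACT**: `(m+1)²·(μ − x)²·x^{2m} ≤ μ^{2m+2}` for `0 ≤ x ≤ μ` — after `m` dressing steps a state at level `x` below the own level `μ`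
contributes to the squared residual at `a = μ` with lever at most `μ²/(m+1)²`, whatever `x` is. [folklore] -/
theorem kinematic_pow_bound (m : ℕ) {x μ : ℝ} (hx : 0 ≤ x) (hxμ : x ≤ μ) :
    ((m : ℝ) + 1) ^ 2 * ((μ - x) ^ 2 * x ^ (2 * m)) ≤ μ ^ (2 * m + 2) := by
  have h := kinematic_bound m hx hxμ
  have h0 : 0 ≤ ((m : ℝ) + 1) * ((μ - x) * x ^ m) := mul_nonneg (by positivity) (mul_nonneg (sub_nonneg.mpr hxμ) (pow_nonneg hx _))
  have hsq := pow_le_pow_left₀ h0 h 2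
  calc ((m : ℝ) + 1) ^ 2 * ((μ - x) ^ 2 * x ^ (2 * m)) = (((m : ℝ) + 1) * ((μ - x) * x ^ m)) ^ 2 := by ring
    _ ≤ (μ ^ (m + 1)) ^ 2 := hsq
    _ = μ ^ (2 * m + 2) := by ring

/-- The lever form: `(μ − x)²·x^{2m} ≤ (μ^{2m+2}/(m+1)²)` for `0 ≤ x ≤ μ`. [folklore] -/
theorem sub_sq_mul_pow_le (m : ℕ) {x μ : ℝ} (hx : 0 ≤ x) (hxμ : x ≤ μ) :
    (μ - x) ^ 2 * x ^ (2 * m) ≤ μ ^ (2 * m + 2) / ((m : ℝ) + 1) ^ 2 := by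
  rw [le_div_iff₀ (by positivity), mul_comm]
  exact kinematic_pow_bound m hx hxμ

/-- **A remainder one e-fold below the own level is enough**: `0 ≤ Λ ≤ μ/e` gives `(m+1)²Λ^{2m} ≤ μ^{2m}` for every `m` (`m + 1 ≤ e^m`). [folklore] -/
theorem gap_of_le_div_exp {Λ μ : ℝ} (hΛ : 0 ≤ Λ) (h : Λ ≤ μ / Real.exp 1) (m : ℕ) :
    ((m : ℝ) + 1) ^ 2 * Λ ^ (2 * m) ≤ μ ^ (2 * m) := by
  have he : 0 < Real.exp 1 := Real.exp_pos 1
  have hΛe : Λ * Real.exp 1 ≤ μ := (le_div_iff₀ he).mp h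
  have h1 : (m : ℝ) + 1 ≤ Real.exp 1 ^ m := by
    have := Real.add_one_le_exp (m : ℝ)
    rwa [← Real.exp_one_pow] at this
  have h2 : ((m : ℝ) + 1) ^ 2 ≤ (Real.exp 1 ^ m) ^ 2 := pow_le_pow_left₀ (by positivity) h1 2
  calc ((m : ℝ) + 1) ^ 2 * Λ ^ (2 * m) ≤ (Real.exp 1 ^ m) ^ 2 * Λ ^ (2 * m) := mul_le_mul_of_nonneg_right h2 (pow_nonneg hΛ _)
    _ = (Λ * Real.exp 1) ^ (2 * m) := by ring
    _ ≤ μ ^ (2 * m) := pow_le_pow_left₀ (mul_nonneg hΛ he.le) hΛe _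

end Kinematic

/-! ## §B Femto: the dressed residual at the own level from slow levers and the weight outside the slow set -/

section Femto

variable {L : ℕ} [NeZero L]

/-- **Pythagoras against an orthonormal physical family**: `‖x‖² = Σ_j ⟨x,ψ_j⟩² + ‖x − Σ_j⟨x,ψ_j⟩ψ_j‖²`. [folklore] -/
theorem normSq_split_eigenfamily {N : ℕ} {ψ : Fin N → (GaugeConfig 3 L SU2 → ℝ)} (hψ : ∀ j, IsPhys (ψ j))
    (hon : ∀ i l, l2 (ψ i) (ψ l) = if i = l then 1 else 0) {x : GaugeConfig 3 L SU2 → ℝ} (hx : IsPhys x) :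
    l2 x x = ∑ j, l2 x (ψ j) ^ 2 + l2 (x - ∑ j, l2 x (ψ j) • ψ j) (x - ∑ j, l2 x (ψ j) • ψ j) := by
  set e : Fin N → physSubmodule L := fun j => ⟨ψ j, hψ j⟩ with he
  have hon' : ∀ i l, l2Form L (e i) (e l) = if i = l then 1 else 0 := fun i l => by
    simpa only [l2Form_apply, he, Submodule.coe_mk] using hon i l
  have h := norm_split (l2Form L) l2Form_symm e hon' ⟨x, hx⟩
  simpa only [l2Form_apply, Submodule.coe_sub, Submodule.coe_sum, Submodule.coe_smul, he] using h

/-- Exact eigenvalues of a normalised physical eigenfamily are nonnegative for `β ≥ 0` (`λ_j = ⟨ψ_j, K_βψ_j⟩ ≥ 0`). [cite: ReedSimonIV1978, Thm XIII.1] -/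
theorem eigen_nonneg {β : ℝ} (hβ : 0 ≤ β) {N : ℕ} {ψ : Fin N → (GaugeConfig 3 L SU2 → ℝ)} (hψ : ∀ j, IsPhys (ψ j))
    (hon : ∀ i l, l2 (ψ i) (ψ l) = if i = l then 1 else 0) (ev : Fin N → ℝ)
    (heig : ∀ j, transferApply β (ψ j) = ev j • ψ j) (j : Fin N) : 0 ≤ ev j := by
  have h := qform_su2Rep_self_nonneg hβ (hψ j)
  rw [qform_eq_l2_transferApply, heig j, l2_smul_right, hon j j, if_pos rfl, mul_one] at h
  exact h

/-- ★★ **The dressed squared residual at the own level, kinematic form.**  `ψ` an exact physical `l2`-orthonormal eigenfamily (levels `λ_j`) dominating at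
`Λ` with `0 ≤ Λ ≤ μ` (`β ≥ 0`); `x` physical; own index `j₀`, `μ = λ_{j₀}`; a slow set `S` with `λ_j ≤ μ` for `j ∉ S`; `(m+1)²Λ^{2m} ≤ μ^{2m}`.  Then
`‖(K_β − μ)K_β^[m]x‖² ≤ Σ_{j∈S} (λ_j − μ)²λ_j^{2m}⟨x,ψ_j⟩² + (μ^{2m+2}/(m+1)²)·(‖x‖² − Σ_{j∈S}⟨x,ψ_j⟩²)`.
[cite: ReedSimonIV1978, Thm XIII.1] [cite: LuscherWolff1990, §2] -/
theorem residual_iterate_le_kinematic {β : ℝ} (hβ : 0 ≤ β) {N : ℕ} {ψ : Fin N → (GaugeConfig 3 L SU2 → ℝ)} (hψ : ∀ j, IsPhys (ψ j))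
    (hon : ∀ i l, l2 (ψ i) (ψ l) = if i = l then 1 else 0) (ev : Fin N → ℝ)
    (heig : ∀ j, transferApply β (ψ j) = ev j • ψ j) {Λ : ℝ} (hΛ : 0 ≤ Λ)
    (hdom : ∀ φ : GaugeConfig 3 L SU2 → ℝ, IsPhys φ → (∀ j, l2 φ (ψ j) = 0) → l2 φ (transferApply β φ) ≤ Λ * l2 φ φ)
    {x : GaugeConfig 3 L SU2 → ℝ} (hx : IsPhys x) (m : ℕ) (j₀ : Fin N) (hΛμ : Λ ≤ ev j₀) (S : Finset (Fin N))
    (hS : ∀ j, j ∉ S → ev j ≤ ev j₀) (hgap : ((m : ℝ) + 1) ^ 2 * Λ ^ (2 * m) ≤ ev j₀ ^ (2 * m)) :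
    l2 (transferApply β ((transferApply β)^[m] x) - ev j₀ • (transferApply β)^[m] x)
        (transferApply β ((transferApply β)^[m] x) - ev j₀ • (transferApply β)^[m] x) ≤
      ∑ j ∈ S, (ev j - ev j₀) ^ 2 * ev j ^ (2 * m) * l2 x (ψ j) ^ 2 +
        ev j₀ ^ (2 * m + 2) / ((m : ℝ) + 1) ^ 2 * (l2 x x - ∑ j ∈ S, l2 x (ψ j) ^ 2) := by
  classical
  set μ := ev j₀ with hμ
  set r := x - ∑ j, l2 x (ψ j) • ψ j with hr_def
  have hr : IsPhys r := by
    have hmem : r ∈ physSubmodule L := by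
      rw [hr_def]; exact Submodule.sub_mem _ hx (Submodule.sum_mem _ fun j _ => Submodule.smul_mem _ _ (hψ j))
    exact hmem
  have hrψ : ∀ j, l2 r (ψ j) = 0 := l2_remainder_eq_zero hψ hon hx
  have hev0 : ∀ j, 0 ≤ ev j := eigen_nonneg hβ hψ hon ev heig
  have hμ0 : 0 ≤ μ := hev0 j₀
  have hm1 : (0 : ℝ) < ((m : ℝ) + 1) ^ 2 := by positivity
  set κ := μ ^ (2 * m + 2) / ((m : ℝ) + 1) ^ 2 with hκ
  have hκ0 : 0 ≤ κ := div_nonneg (pow_nonneg hμ0 _) hm1.le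
  set T : Fin N → ℝ := fun j => (ev j - μ) ^ 2 * ev j ^ (2 * m) * l2 x (ψ j) ^ 2 with hT
  set w : Fin N → ℝ := fun j => l2 x (ψ j) ^ 2 with hw
  -- the exact split (XI-b) and Pythagoras
  have hsplit := residual_iterate_split_eigenfamily β hψ hon ev heig hx μ m
  have hnorm := normSq_split_eigenfamily hψ hon hx
  have hsumT : ∑ j, T j = ∑ j ∈ S, T j + ∑ j ∈ Sᶜ, T j := (sum_add_sum_compl S T).symm
  have hsumw : ∑ j, w j = ∑ j ∈ S, w j + ∑ j ∈ Sᶜ, w j := (sum_add_sum_compl S w).symm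
  -- off `S`: the kinematic lever
  have hoff : ∑ j ∈ Sᶜ, T j ≤ κ * ∑ j ∈ Sᶜ, w j := by
    rw [mul_sum]
    refine sum_le_sum fun j hj => ?_
    have hj' : j ∉ S := mem_compl.mp hj
    have hk := sub_sq_mul_pow_le m (hev0 j) (hS j hj')
    simp only [hT, hw]
    rw [show (ev j - μ) ^ 2 = (μ - ev j) ^ 2 by ring]
    exact mul_le_mul_of_nonneg_right hk (sq_nonneg _)
  -- the remainder: `‖(K−μ)K^m r‖² ≤ max(μ²,(Λ−μ)²)·Λ^{2m}‖r‖² ≤ κ‖r‖²`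
  obtain ⟨-, hrem⟩ := iterate_remainder_bounds hβ hψ ev heig hΛ hdom hr hrψ μ m
  have hmax : max (μ ^ 2) ((Λ - μ) ^ 2) = μ ^ 2 := by
    refine max_eq_left ?_
    nlinarith [hΛ, hΛμ]
  have hΛm : μ ^ 2 * Λ ^ (2 * m) ≤ κ := by
    rw [hκ, le_div_iff₀ hm1]
    calc μ ^ 2 * Λ ^ (2 * m) * (((m : ℝ) + 1) ^ 2) = μ ^ 2 * ((((m : ℝ) + 1) ^ 2) * Λ ^ (2 * m)) := by ring
      _ ≤ μ ^ 2 * μ ^ (2 * m) := mul_le_mul_of_nonneg_left hgap (sq_nonneg _)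
      _ = μ ^ (2 * m + 2) := by ring
  have hrem' : l2 (transferApply β ((transferApply β)^[m] r) - μ • (transferApply β)^[m] r)
      (transferApply β ((transferApply β)^[m] r) - μ • (transferApply β)^[m] r) ≤ κ * l2 r r := by
    rw [hmax] at hrem
    calc _ ≤ μ ^ 2 * (Λ ^ (2 * m) * l2 r r) := hrem
      _ = (μ ^ 2 * Λ ^ (2 * m)) * l2 r r := by ring
      _ ≤ κ * l2 r r := mul_le_mul_of_nonneg_right hΛm (l2_self_nonneg r)
  -- assemble
  have hout : ∑ j ∈ Sᶜ, w j + l2 r r = l2 x x - ∑ j ∈ S, w j := by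
    have : l2 x x = ∑ j, w j + l2 r r := hnorm
    rw [this, hsumw]; ring
  calc l2 (transferApply β ((transferApply β)^[m] x) - μ • (transferApply β)^[m] x)
        (transferApply β ((transferApply β)^[m] x) - μ • (transferApply β)^[m] x)
      = ∑ j, T j + l2 (transferApply β ((transferApply β)^[m] r) - μ • (transferApply β)^[m] r)
          (transferApply β ((transferApply β)^[m] r) - μ • (transferApply β)^[m] r) := hsplit
    _ ≤ (∑ j ∈ S, T j + κ * ∑ j ∈ Sᶜ, w j) + κ * l2 r r := by rw [hsumT]; linarith [hoff, hrem']
    _ = ∑ j ∈ S, T j + κ * (∑ j ∈ Sᶜ, w j + l2 r r) := by ring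
    _ = ∑ j ∈ S, T j + κ * (l2 x x - ∑ j ∈ S, w j) := by rw [hout]

/-- ★★ **Relative form**: under the hypotheses of `residual_iterate_le_kinematic`, if
`Σ_{j∈S} (λ_j − μ)²λ_j^{2m}⟨x,ψ_j⟩² + (μ^{2m+2}/(m+1)²)(‖x‖² − Σ_{j∈S}⟨x,ψ_j⟩²) ≤ ρ·μ^{2m}·⟨x,ψ_{j₀}⟩²` (`ρ ≥ 0`) then
`‖(K_β − μ)K_β^[m]x‖² ≤ ρ·‖K_β^[m]x‖²`. [cite: ReedSimonIV1978, Thm XIII.1] [cite: LuscherWolff1990, §2] -/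
theorem residual_iterate_le_of_slow_outside {β : ℝ} (hβ : 0 ≤ β) {N : ℕ} {ψ : Fin N → (GaugeConfig 3 L SU2 → ℝ)} (hψ : ∀ j, IsPhys (ψ j))
    (hon : ∀ i l, l2 (ψ i) (ψ l) = if i = l then 1 else 0) (ev : Fin N → ℝ)
    (heig : ∀ j, transferApply β (ψ j) = ev j • ψ j) {Λ : ℝ} (hΛ : 0 ≤ Λ)
    (hdom : ∀ φ : GaugeConfig 3 L SU2 → ℝ, IsPhys φ → (∀ j, l2 φ (ψ j) = 0) → l2 φ (transferApply β φ) ≤ Λ * l2 φ φ)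
    {x : GaugeConfig 3 L SU2 → ℝ} (hx : IsPhys x) (m : ℕ) (j₀ : Fin N) (hΛμ : Λ ≤ ev j₀) (S : Finset (Fin N))
    (hS : ∀ j, j ∉ S → ev j ≤ ev j₀) (hgap : ((m : ℝ) + 1) ^ 2 * Λ ^ (2 * m) ≤ ev j₀ ^ (2 * m)) {ρ : ℝ} (hρ : 0 ≤ ρ)
    (h : ∑ j ∈ S, (ev j - ev j₀) ^ 2 * ev j ^ (2 * m) * l2 x (ψ j) ^ 2 +
        ev j₀ ^ (2 * m + 2) / ((m : ℝ) + 1) ^ 2 * (l2 x x - ∑ j ∈ S, l2 x (ψ j) ^ 2) ≤ ρ * (ev j₀ ^ (2 * m) * l2 x (ψ j₀) ^ 2)) :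
    l2 (transferApply β ((transferApply β)^[m] x) - ev j₀ • (transferApply β)^[m] x)
        (transferApply β ((transferApply β)^[m] x) - ev j₀ • (transferApply β)^[m] x) ≤
      ρ * l2 ((transferApply β)^[m] x) ((transferApply β)^[m] x) :=
  calc _ ≤ _ := residual_iterate_le_kinematic hβ hψ hon ev heig hΛ hdom hx m j₀ hΛμ S hS hgap
    _ ≤ ρ * (ev j₀ ^ (2 * m) * l2 x (ψ j₀) ^ 2) := h
    _ ≤ ρ * l2 ((transferApply β)^[m] x) ((transferApply β)^[m] x) :=
        mul_le_mul_of_nonneg_left (normSq_iterate_ge_level β hψ hon ev heig hx m j₀) hρ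

end Femto

/-! ## §C The press-buttons in the stub's currency (`m = dressSteps L = L`) -/

section Dressed

open Summit.QuantumFields.YangMills.Theorems.FemtoTransferGap.PolyakovLift

variable {L : ℕ} [NeZero L]

/-- Arithmetic of the (OUT) term at `m = L`: `(μ^{2L+2}/(L+1)²)·Y ≤ (λ₀²/L²)·μ^{2L}·Y` for `0 ≤ μ ≤ λ₀`, `Y ≥ 0`. [folklore] -/
theorem out_term_le {μ l0 Y : ℝ} (hμ0 : 0 ≤ μ) (hμ : μ ≤ l0) (hY : 0 ≤ Y) :
    μ ^ (2 * dressSteps L + 2) / ((dressSteps L : ℝ) + 1) ^ 2 * Y ≤ l0 ^ 2 / (L : ℝ) ^ 2 * (μ ^ (2 * dressSteps L) * Y) := by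
  have hL : (0 : ℝ) < L := Nat.cast_pos.mpr (NeZero.pos L)
  simp only [dressSteps]
  have h1 : μ ^ (2 * L + 2) / ((L : ℝ) + 1) ^ 2 ≤ l0 ^ 2 / (L : ℝ) ^ 2 * μ ^ (2 * L) := by
    rw [div_le_iff₀ (by positivity)]
    calc μ ^ (2 * L + 2) = μ ^ 2 * μ ^ (2 * L) := by ring
      _ ≤ l0 ^ 2 * μ ^ (2 * L) := mul_le_mul_of_nonneg_right (pow_le_pow_left₀ hμ0 hμ 2) (pow_nonneg hμ0 _)
      _ = l0 ^ 2 / (L : ℝ) ^ 2 * μ ^ (2 * L) * (L : ℝ) ^ 2 := by field_simp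
      _ ≤ l0 ^ 2 / (L : ℝ) ^ 2 * μ ^ (2 * L) * ((L : ℝ) + 1) ^ 2 := by
          apply mul_le_mul_of_nonneg_left _ (mul_nonneg (div_nonneg (sq_nonneg _) (sq_nonneg _)) (pow_nonneg hμ0 _))
          nlinarith
  calc μ ^ (2 * L + 2) / ((L : ℝ) + 1) ^ 2 * Y ≤ (l0 ^ 2 / (L : ℝ) ^ 2 * μ ^ (2 * L)) * Y := mul_le_mul_of_nonneg_right h1 hY
    _ = l0 ^ 2 / (L : ℝ) ^ 2 * (μ ^ (2 * L) * Y) := by ring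

/-- ★★ **(RL) for ONE dressed vector `v = K_β^[L] x` from (SLOW) + (OUT)** (`x` physical, e.g. `x = liftVec β Ω (ψ_n/Ω₁)`; `β ≥ 0`): with an exact
eigenfamily dominating at `Λ`, own index `j₀` (`μ = λ_{j₀} ≤ λ₀`, `0 ≤ Λ ≤ μ`, `(L+1)²Λ^{2L} ≤ μ^{2L}`), a slow set `S` (`λ_j ≤ μ` off `S`), own weight
`w₀ = ⟨x,ψ_{j₀}⟩²`, constants `C₁, C₂ ≥ 0`:
(SLOW) `Σ_{j∈S}(λ_j − μ)²λ_j^{2L}⟨x,ψ_j⟩² ≤ C₁(λ³/L²)λ₀²·μ^{2L}w₀` and (OUT) `‖x‖² − Σ_{j∈S}⟨x,ψ_j⟩² ≤ C₂λ³·w₀`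
give `‖(K_β − μ)v‖² ≤ (C₁ + C₂)(λ³/L²)λ₀²·‖v‖²`. [cite: Kato1949, §1] [cite: LuscherWolff1990, §2] -/
theorem residual_dressed_le_of_slow_outside {β : ℝ} (hβ : 0 ≤ β) {N : ℕ} {ψ : Fin N → (GaugeConfig 3 L SU2 → ℝ)} (hψ : ∀ j, IsPhys (ψ j))
    (hon : ∀ i l, l2 (ψ i) (ψ l) = if i = l then 1 else 0) (ev : Fin N → ℝ)
    (heig : ∀ j, transferApply β (ψ j) = ev j • ψ j) {Λ : ℝ} (hΛ : 0 ≤ Λ)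
    (hdom : ∀ φ : GaugeConfig 3 L SU2 → ℝ, IsPhys φ → (∀ j, l2 φ (ψ j) = 0) → l2 φ (transferApply β φ) ≤ Λ * l2 φ φ)
    {x : GaugeConfig 3 L SU2 → ℝ} (hx : IsPhys x) (j₀ : Fin N) (hΛμ : Λ ≤ ev j₀) (hμtop : ev j₀ ≤ levelValue su2Rep L β 0)
    (S : Finset (Fin N)) (hS : ∀ j, j ∉ S → ev j ≤ ev j₀)
    (hgap : ((dressSteps L : ℝ) + 1) ^ 2 * Λ ^ (2 * dressSteps L) ≤ ev j₀ ^ (2 * dressSteps L)) {C₁ C₂ : ℝ} (hC₁ : 0 ≤ C₁) (hC₂ : 0 ≤ C₂)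
    (hslow : ∑ j ∈ S, (ev j - ev j₀) ^ 2 * ev j ^ (2 * dressSteps L) * l2 x (ψ j) ^ 2 ≤
      C₁ * (luscherLambda β L ^ 3 / (L : ℝ) ^ 2) * levelValue su2Rep L β 0 ^ 2 * (ev j₀ ^ (2 * dressSteps L) * l2 x (ψ j₀) ^ 2))
    (hout : l2 x x - ∑ j ∈ S, l2 x (ψ j) ^ 2 ≤ C₂ * luscherLambda β L ^ 3 * l2 x (ψ j₀) ^ 2) :
    l2 (transferApply β ((transferApply β)^[dressSteps L] x) - ev j₀ • (transferApply β)^[dressSteps L] x)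
        (transferApply β ((transferApply β)^[dressSteps L] x) - ev j₀ • (transferApply β)^[dressSteps L] x) ≤
      (C₁ + C₂) * (luscherLambda β L ^ 3 / (L : ℝ) ^ 2) * levelValue su2Rep L β 0 ^ 2 *
        l2 ((transferApply β)^[dressSteps L] x) ((transferApply β)^[dressSteps L] x) := by
  set μ := ev j₀ with hμ
  set l0 := levelValue su2Rep L β 0 with hl0
  set lam3 := luscherLambda β L ^ 3 with hlam3
  have hμ0 : 0 ≤ μ := eigen_nonneg hβ hψ hon ev heig j₀
  have hlam : 0 ≤ lam3 := pow_nonneg (by unfold luscherLambda; exact Real.rpow_nonneg (le_max_right _ _) _) 3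
  have hLpos : (0 : ℝ) < L := Nat.cast_pos.mpr (NeZero.pos L)
  have hw0 : 0 ≤ l2 x (ψ j₀) ^ 2 := sq_nonneg _
  have hY : 0 ≤ l2 x x - ∑ j ∈ S, l2 x (ψ j) ^ 2 := by
    classical
    have hnorm := normSq_split_eigenfamily hψ hon hx
    have hsumw := (sum_add_sum_compl S (fun j => l2 x (ψ j) ^ 2)).symm
    have hc : 0 ≤ ∑ j ∈ Sᶜ, l2 x (ψ j) ^ 2 := sum_nonneg fun j _ => sq_nonneg _
    linarith [l2_self_nonneg (x - ∑ j, l2 x (ψ j) • ψ j)]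
  have hρ : 0 ≤ (C₁ + C₂) * (lam3 / (L : ℝ) ^ 2) * l0 ^ 2 :=
    mul_nonneg (mul_nonneg (add_nonneg hC₁ hC₂) (div_nonneg hlam (sq_nonneg _))) (sq_nonneg _)
  refine residual_iterate_le_of_slow_outside hβ hψ hon ev heig hΛ hdom hx (dressSteps L) j₀ hΛμ S hS hgap hρ ?_
  -- (OUT): `κ·Y ≤ (l0²/L²)·μ^{2L}·Y ≤ (l0²/L²)·μ^{2L}·C₂λ³·w₀`
  have hout' : μ ^ (2 * dressSteps L + 2) / ((dressSteps L : ℝ) + 1) ^ 2 * (l2 x x - ∑ j ∈ S, l2 x (ψ j) ^ 2) ≤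
      C₂ * (lam3 / (L : ℝ) ^ 2) * l0 ^ 2 * (μ ^ (2 * dressSteps L) * l2 x (ψ j₀) ^ 2) :=
    calc _ ≤ l0 ^ 2 / (L : ℝ) ^ 2 * (μ ^ (2 * dressSteps L) * (l2 x x - ∑ j ∈ S, l2 x (ψ j) ^ 2)) := out_term_le hμ0 hμtop hY
      _ ≤ l0 ^ 2 / (L : ℝ) ^ 2 * (μ ^ (2 * dressSteps L) * (C₂ * lam3 * l2 x (ψ j₀) ^ 2)) :=
          mul_le_mul_of_nonneg_left (mul_le_mul_of_nonneg_left hout (pow_nonneg hμ0 _)) (div_nonneg (sq_nonneg _) (sq_nonneg _))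
      _ = C₂ * (lam3 / (L : ℝ) ^ 2) * l0 ^ 2 * (μ ^ (2 * dressSteps L) * l2 x (ψ j₀) ^ 2) := by
          field_simp
  calc _ ≤ C₁ * (lam3 / (L : ℝ) ^ 2) * l0 ^ 2 * (μ ^ (2 * dressSteps L) * l2 x (ψ j₀) ^ 2) +
          C₂ * (lam3 / (L : ℝ) ^ 2) * l0 ^ 2 * (μ ^ (2 * dressSteps L) * l2 x (ψ j₀) ^ 2) := add_le_add hslow hout'
    _ = (C₁ + C₂) * (lam3 / (L : ℝ) ^ 2) * l0 ^ 2 * (μ ^ (2 * dressSteps L) * l2 x (ψ j₀) ^ 2) := by ring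

/-- ★★★ **Press-button for the r5 S-LEAK family: `LeakageClause k C β (dressedLiftFamily β φ g)` from (SLOW) + (OUT) per channel** (undressed
`x_i = liftVec β φ g_i`; `φ`, `g_i` physical; `β ≥ 0`; per channel an exact eigenfamily dominating at `Λ`, own index `j₀` with `λ_{j₀} ≤ λ₀`, `0 ≤ Λ ≤ λ_{j₀}`,
`(L+1)²Λ^{2L} ≤ λ_{j₀}^{2L}`, a slow set `S`, constants `C₁ + C₂ ≤ C`). [cite: Kato1949, §1] [cite: LuscherWolff1990, §2] [cite: Luscher1983, §3] -/
theorem leakageClause_dressed_of_slow_outside {k : ℕ} {C β : ℝ} (hβ : 0 ≤ β) {φ : GaugeConfig 3 L SU2 → ℝ} (hφ : IsPhys φ)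
    {g : Fin k → (GaugeConfig 3 1 SU2 → ℝ)} (hg : ∀ i, IsPhys (g i))
    (h : ∀ i : Fin k, ∃ (N : ℕ) (ψ : Fin N → (GaugeConfig 3 L SU2 → ℝ)) (ev : Fin N → ℝ) (Λ : ℝ) (j₀ : Fin N) (S : Finset (Fin N))
      (C₁ C₂ : ℝ),
      (∀ j, IsPhys (ψ j)) ∧ (∀ j l, l2 (ψ j) (ψ l) = if j = l then 1 else 0) ∧
      (∀ j, transferApply β (ψ j) = ev j • ψ j) ∧ 0 ≤ Λ ∧ Λ ≤ ev j₀ ∧ ev j₀ ≤ levelValue su2Rep L β 0 ∧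
      (∀ χ : GaugeConfig 3 L SU2 → ℝ, IsPhys χ → (∀ j, l2 χ (ψ j) = 0) → l2 χ (transferApply β χ) ≤ Λ * l2 χ χ) ∧
      (∀ j, j ∉ S → ev j ≤ ev j₀) ∧ ((dressSteps L : ℝ) + 1) ^ 2 * Λ ^ (2 * dressSteps L) ≤ ev j₀ ^ (2 * dressSteps L) ∧
      0 ≤ C₁ ∧ 0 ≤ C₂ ∧ C₁ + C₂ ≤ C ∧
      ∑ j ∈ S, (ev j - ev j₀) ^ 2 * ev j ^ (2 * dressSteps L) * l2 (liftVec β φ (g i)) (ψ j) ^ 2 ≤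
        C₁ * (luscherLambda β L ^ 3 / (L : ℝ) ^ 2) * levelValue su2Rep L β 0 ^ 2 *
          (ev j₀ ^ (2 * dressSteps L) * l2 (liftVec β φ (g i)) (ψ j₀) ^ 2) ∧
      l2 (liftVec β φ (g i)) (liftVec β φ (g i)) - ∑ j ∈ S, l2 (liftVec β φ (g i)) (ψ j) ^ 2 ≤
        C₂ * luscherLambda β L ^ 3 * l2 (liftVec β φ (g i)) (ψ j₀) ^ 2) :
    LeakageClause k C β (dressedLiftFamily β φ g) := by
  refine leakageClause_of_residual C β (fun i => isPhys_dressedLiftVec β hφ (hg i)) fun i => ?_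
  obtain ⟨N, ψ, ev, Λ, j₀, S, C₁, C₂, hψ, hon, heig, hΛ, hΛμ, hμtop, hdom, hS, hgap, hC₁, hC₂, hC, hslow, hout⟩ := h i
  refine ⟨ev j₀, ?_⟩
  have hmain := residual_dressed_le_of_slow_outside hβ hψ hon ev heig hΛ hdom (isPhys_liftVec β hφ (hg i)) j₀ hΛμ hμtop S hS hgap
    hC₁ hC₂ hslow hout
  have hnn : 0 ≤ (luscherLambda β L ^ 3 / (L : ℝ) ^ 2) * levelValue su2Rep L β 0 ^ 2 *
      l2 (dressedLiftFamily β φ g i) (dressedLiftFamily β φ g i) :=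
    mul_nonneg (mul_nonneg (div_nonneg (pow_nonneg (by unfold luscherLambda; exact Real.rpow_nonneg (le_max_right _ _) _) 3)
      (sq_nonneg _)) (sq_nonneg _)) (l2_self_nonneg _)
  calc _ ≤ (C₁ + C₂) * (luscherLambda β L ^ 3 / (L : ℝ) ^ 2) * levelValue su2Rep L β 0 ^ 2 *
        l2 (dressedLiftFamily β φ g i) (dressedLiftFamily β φ g i) := hmain
    _ = (C₁ + C₂) * ((luscherLambda β L ^ 3 / (L : ℝ) ^ 2) * levelValue su2Rep L β 0 ^ 2 *
        l2 (dressedLiftFamily β φ g i) (dressedLiftFamily β φ g i)) := by ring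
    _ ≤ C * ((luscherLambda β L ^ 3 / (L : ℝ) ^ 2) * levelValue su2Rep L β 0 ^ 2 *
        l2 (dressedLiftFamily β φ g i) (dressedLiftFamily β φ g i)) := mul_le_mul_of_nonneg_right hC hnn
    _ = _ := by ring

/-- ★★ **(RL) of the closing press-buttons IX∕X for ONE dressed reference lift `v = dressedLiftVec β Ω G` from (SLOW) + (OUT)** on the undressed
`x = liftVec β Ω G` (`Ω`, `G` physical), at the own exact fine level `a = λ_{j₀}` and rate `ρ = (C₁ + C₂)(λ³/L²)λ₀²`. [cite: Kato1949, §1] [cite: LuscherWolff1990, §2] -/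
theorem residual_dressedLiftVec_le_of_slow_outside {β : ℝ} (hβ : 0 ≤ β) {Ω : GaugeConfig 3 L SU2 → ℝ} (hΩ : IsPhys Ω)
    {G : GaugeConfig 3 1 SU2 → ℝ} (hG : IsPhys G) {N : ℕ} {ψ : Fin N → (GaugeConfig 3 L SU2 → ℝ)} (hψ : ∀ j, IsPhys (ψ j))
    (hon : ∀ i l, l2 (ψ i) (ψ l) = if i = l then 1 else 0) (ev : Fin N → ℝ)
    (heig : ∀ j, transferApply β (ψ j) = ev j • ψ j) {Λ : ℝ} (hΛ : 0 ≤ Λ)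
    (hdom : ∀ χ : GaugeConfig 3 L SU2 → ℝ, IsPhys χ → (∀ j, l2 χ (ψ j) = 0) → l2 χ (transferApply β χ) ≤ Λ * l2 χ χ)
    (j₀ : Fin N) (hΛμ : Λ ≤ ev j₀) (hμtop : ev j₀ ≤ levelValue su2Rep L β 0)
    (S : Finset (Fin N)) (hS : ∀ j, j ∉ S → ev j ≤ ev j₀)
    (hgap : ((dressSteps L : ℝ) + 1) ^ 2 * Λ ^ (2 * dressSteps L) ≤ ev j₀ ^ (2 * dressSteps L)) {C₁ C₂ : ℝ} (hC₁ : 0 ≤ C₁) (hC₂ : 0 ≤ C₂)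
    (hslow : ∑ j ∈ S, (ev j - ev j₀) ^ 2 * ev j ^ (2 * dressSteps L) * l2 (liftVec β Ω G) (ψ j) ^ 2 ≤
      C₁ * (luscherLambda β L ^ 3 / (L : ℝ) ^ 2) * levelValue su2Rep L β 0 ^ 2 * (ev j₀ ^ (2 * dressSteps L) * l2 (liftVec β Ω G) (ψ j₀) ^ 2))
    (hout : l2 (liftVec β Ω G) (liftVec β Ω G) - ∑ j ∈ S, l2 (liftVec β Ω G) (ψ j) ^ 2 ≤
      C₂ * luscherLambda β L ^ 3 * l2 (liftVec β Ω G) (ψ j₀) ^ 2) :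
    l2 (transferApply β (dressedLiftVec β Ω G) - ev j₀ • dressedLiftVec β Ω G)
        (transferApply β (dressedLiftVec β Ω G) - ev j₀ • dressedLiftVec β Ω G) ≤
      (C₁ + C₂) * (luscherLambda β L ^ 3 / (L : ℝ) ^ 2) * levelValue su2Rep L β 0 ^ 2 *
        l2 (dressedLiftVec β Ω G) (dressedLiftVec β Ω G) :=
  residual_dressed_le_of_slow_outside hβ hψ hon ev heig hΛ hdom (isPhys_liftVec β hΩ hG) j₀ hΛμ hμtop S hS hgap hC₁ hC₂ hslow hout

end Dressed

end Summit.QuantumFields.YangMills.Theorems.FemtoTransferGap.LiftLeak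

end
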